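import Mathlib
import Summits.Ventures.PercRepro2.Defs
import Summits.Ventures.PercRepro2.Harris
import Summits.Ventures.PercRepro2.Events
import Summits.Ventures.PercRepro2.TReduction
import Summits.Ventures.PercRepro2.TReductionBase
import Summits.Ventures.PercRepro2.KTwoFiveNegative

/-!
# `(T_h)` itself is strictly positive on `K_{2,5}` at `p ≡ ½` for the events of the negative base case
(blind cell PercRepro2, mine-a g48)

Companion of `KTwoFiveNegative`: there the antipodal base case of the lane's reduction is `−3`
on `K_{2,5}` for `Q = {h ∈ C_r}`, `U = {x₀, x₁ ∈ C_r}`, `e = {x₂, x₃, x₄ ∈ C_r}`.  Here the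
three-event form itself, at the uniform weights `p ≡ ½`, equals `3843 / 131072 > 0`
(`t_half_eq`, `t_half_pos`): the negative base case does not refute `(T_h)` — it is one summand
`Π_e p_e(1 − p_e) · K_E` of the Bernstein expansion, outweighed by the others (MINE-A.md §103.1,
proofs/MINEA-THETA.md §2).  Under `p ≡ ½` every configuration has weight `2⁻¹⁰`, so each
probability is `2⁻¹⁰` times a count of configurations (`prob_half_eq`); the seven counts
(`781, 495, 369, 468, 360, 212, 211`) are evaluated by `decide` over ten nested Boolean sums
(`sum_pi_succ`).  No instance, no notation.
-/

namespace Summit.Ventures.PercRepro2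

namespace KTwoFive

open Finset

section Half

variable {R : Type*} [Field R] [LinearOrder R] [IsStrictOrderedRing R]

/-- The uniform weights `p ≡ 1/2`. -/
def half : Fin 10 → R := fun _ => 1 / 2

/-- Every configuration has weight `2⁻¹⁰` under the uniform weights. -/
lemma weight_half (ω : Config (Fin 10)) : weight (half (R := R)) ω = (1 / 2) ^ 10 := by
  unfold weight half edgeFactor
  have h : ∀ e : Fin 10, (if ω e = true then (1 / 2 : R) else 1 - 1 / 2) = 1 / 2 := by
    intro e
    split_ifs <;> norm_num
  simp only [h, prod_const, card_univ, Fintype.card_fin]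

/-- The integer count of the configurations satisfying a Boolean predicate. -/
def count (b : Config (Fin 10) → Bool) : ℤ := ∑ ω : Config (Fin 10), if b ω then 1 else 0

/-- Under the uniform weights, the probability of an event decided by `b` is `2⁻¹⁰` times its count. -/
lemma prob_half_eq {A : Set (Config (Fin 10))} {b : Config (Fin 10) → Bool}
    (h : ∀ ω, ω ∈ A ↔ b ω = true) :
    prob (half (R := R)) A = (1 / 2) ^ 10 * ((count b : ℤ) : R) := by
  unfold prob count
  rw [Int.cast_sum, mul_sum]
  refine sum_congr rfl fun ω _ => ?_
  by_cases hb : b ω = true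
  · rw [Set.indicator_of_mem ((h ω).2 hb), if_pos hb, weight_half]; simp
  · rw [Set.indicator_of_notMem (fun hc => hb ((h ω).1 hc)), if_neg hb]; simp

/-- `Q` has `781` configurations. -/
lemma count_Q : count hitB = 781 := by
  show ∑ ω : Fin 10 → Bool, (if hitB ω then (1 : ℤ) else 0) = 781
  simp only [sum_pi_succ]
  decide

/-- `U` has `495` configurations. -/
lemma count_U : count uB = 495 := by
  show ∑ ω : Fin 10 → Bool, (if uB ω then (1 : ℤ) else 0) = 495
  simp only [sum_pi_succ]
  decide

/-- `e` has `369` configurations. -/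
lemma count_e : count eB = 369 := by
  show ∑ ω : Fin 10 → Bool, (if eB ω then (1 : ℤ) else 0) = 369
  simp only [sum_pi_succ]
  decide

/-- `Q ∩ U` has `468` configurations. -/
lemma count_QU : count (fun ω => hitB ω && uB ω) = 468 := by
  show ∑ ω : Fin 10 → Bool, (if hitB ω && uB ω then (1 : ℤ) else 0) = 468
  simp only [sum_pi_succ]
  decide

/-- `Q ∩ e` has `360` configurations. -/
lemma count_Qe : count (fun ω => hitB ω && eB ω) = 360 := by
  show ∑ ω : Fin 10 → Bool, (if hitB ω && eB ω then (1 : ℤ) else 0) = 360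
  simp only [sum_pi_succ]
  decide

/-- `U ∩ e` has `212` configurations. -/
lemma count_Ue : count (fun ω => uB ω && eB ω) = 212 := by
  show ∑ ω : Fin 10 → Bool, (if uB ω && eB ω then (1 : ℤ) else 0) = 212
  simp only [sum_pi_succ]
  decide

/-- `Q ∩ U ∩ e` has `211` configurations. -/
lemma count_QUe : count (fun ω => hitB ω && uB ω && eB ω) = 211 := by
  show ∑ ω : Fin 10 → Bool, (if hitB ω && uB ω && eB ω then (1 : ℤ) else 0) = 211
  simp only [sum_pi_succ]
  decide

/-- Membership in an intersection is decided by the conjunction. -/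
lemma mem_inter_iff_and {A B : Set (Config (Fin 10))} {a b : Config (Fin 10) → Bool}
    (hA : ∀ ω, ω ∈ A ↔ a ω = true) (hB : ∀ ω, ω ∈ B ↔ b ω = true) (ω : Config (Fin 10)) :
    ω ∈ A ∩ B ↔ (a ω && b ω) = true := by
  rw [Set.mem_inter_iff, hA, hB, Bool.and_eq_true]

/-- The uniform weights are admissible. -/
lemma isProbVec_half : IsProbVec (half (R := R)) :=
  ⟨fun _ => by unfold half; norm_num, fun _ => by unfold half; norm_num⟩

/-- **`(T_h)` itself holds strictly on `K_{2,5}` at `p ≡ ½` for the events of the negative base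
case**: `T = 3843 / 131072`. -/
theorem t_half_eq :
    let Q := clusterInEvent ends 0 {T : Set (Fin 7) | (1 : Fin 7) ∈ T}
    let U := clusterInEvent ends 0 𝓤
    let e := clusterInEvent ends 0 𝓥
    prob (half (R := R)) (Q ∩ U ∩ e) + prob half Q * prob half (U ∩ e)
      - prob half (Q ∩ U) * prob half e - prob half (Q ∩ e) * prob half U = 3843 / 131072 := by
  intro Q U e
  rw [prob_half_eq (mem_inter_iff_and (mem_inter_iff_and mem_Q_iff mem_U_iff) mem_e_iff),
    prob_half_eq mem_Q_iff, prob_half_eq (mem_inter_iff_and mem_U_iff mem_e_iff),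
    prob_half_eq (mem_inter_iff_and mem_Q_iff mem_U_iff), prob_half_eq mem_e_iff,
    prob_half_eq (mem_inter_iff_and mem_Q_iff mem_e_iff), prob_half_eq mem_U_iff,
    count_QUe, count_Q, count_Ue, count_QU, count_e, count_Qe, count_U]
  norm_num

/-- `(T_h)` is strictly positive there. -/
theorem t_half_pos :
    0 < prob (half (R := R)) (clusterInEvent ends 0 {T : Set (Fin 7) | (1 : Fin 7) ∈ T}
          ∩ clusterInEvent ends 0 𝓤 ∩ clusterInEvent ends 0 𝓥)
        + prob half (clusterInEvent ends 0 {T : Set (Fin 7) | (1 : Fin 7) ∈ T})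
          * prob half (clusterInEvent ends 0 𝓤 ∩ clusterInEvent ends 0 𝓥)
        - prob half (clusterInEvent ends 0 {T : Set (Fin 7) | (1 : Fin 7) ∈ T}
            ∩ clusterInEvent ends 0 𝓤) * prob half (clusterInEvent ends 0 𝓥)
        - prob half (clusterInEvent ends 0 {T : Set (Fin 7) | (1 : Fin 7) ∈ T}
            ∩ clusterInEvent ends 0 𝓥) * prob half (clusterInEvent ends 0 𝓤) := by
  have h := t_half_eq (R := R)
  simp only at h
  rw [h]
  norm_num

end Half

end KTwoFive

end Summit.Ventures.PercRepro2
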